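import Summits.AnomalousDissipation.AnomalousDissipation.Theorems.SawtoothPulseCascadeK1LocalisedCascadeKHSheetPairEnergyUpper
import Summits.AnomalousDissipation.AnomalousDissipation.Theorems.SawtoothPulseCascadeK1LocalisedCascadeKHStableDetuning

/-!
# K2 lane (route-2 `SawtoothPulseCascade`, crux dir `K1LocalisedCascade`): energy of the comb-column's created pair (`a ≥ 4`)

Helper file of the K2 lane (ACL item stmt-AnomalousDissipation-19491; E5 tail of the S4 line, arbiter A26-12/A26-13 «P2-T»). The Gram constant
of a bare kink-sheet pair at `a ≥ 4` (any Bloch phase): `−Σ₀ + |S| ≤ (1+q)/(2a(1−q)) + √q/(a(1−q)) ≤ 1.00002/(2a)` (`q = e^{−2πa} ≤ (1/400)⁴`;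
`gram_upper_le_of_four_le`), so two created amplitudes `‖q₀‖, ‖q₁‖ ≤ B/a` carry pair energy `≤ 1.00002·B²/(2πa³)` (`comb_pair_energy_le`, via the
exact lattice energy `…KHSheetPairEnergyUpper.sheetPair_energy_le`). With `B = 0.8865` (`…KHCombAmplitude`) the created energy of a comb column of
unit amplitude is `≤ 0.1251/a³ = (4.94/a) × (column energy 1/(4π²a²))`: the `1/|b|` law of the S4 line's E5 table with `C² ≤ 4.94`, `C ≤ 2.23`
(`comb_pair_energy_num_le`). No definitions; no statement about the crux. [cite: Drazin2002, §8.3 (8.36)–(8.38)] [problem: turb]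
-/

-- `Summit.<Summit>.<Problem>`: single-conjunct summit, the duplicate namespace segment is deliberate.
set_option linter.dupNamespace false

noncomputable section

namespace Summit.AnomalousDissipation.AnomalousDissipation.Theorems.SawtoothPulseCascade.K2PhaseBudget

open Set Literature.Analysis.FluidPDE.SawtoothCascade

/-- `q = e^{−2πa} ≤ (1/400)⁴` for `a ≥ 4` (`e^{−2π(a/4)} ≤ 1/400`). [folklore] -/
theorem sawQ_le_of_four_le {a : ℝ} (ha : 4 ≤ a) : sawQ a ≤ (1 / 400) ^ 4 := by
  have h := sawQ_le_of_one_le (show (1 : ℝ) ≤ a / 4 by linarith)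
  unfold sawQ at h ⊢
  have e : Real.exp (-(2 * Real.pi * a)) = Real.exp (-(2 * Real.pi * (a / 4))) ^ 4 := by
    rw [← Real.exp_nat_mul]; congr 1; push_cast; ring
  rw [e]
  exact pow_le_pow_left₀ (Real.exp_pos _).le h 4

/-- **Gram constant at `a ≥ 4`:** `−Σ₀(a,β) + |S_β(a)| ≤ 1.00002/(2a)`. [cite: Drazin2002, §8.3 (8.36)–(8.38)] -/
theorem gram_upper_le_of_four_le {a : ℝ} (ha : 4 ≤ a) (β : ℝ) :
    -sawSigma0 a β + Real.sqrt (Complex.normSq (sawS a β)) ≤ 1.00002 / (2 * a) := by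
  have ha0 : 0 < a := by linarith
  have h := gram_upper_le ha0 β
  have hq0 : 0 < sawQ a := sawQ_pos a
  have hq : sawQ a ≤ (1 / 400) ^ 4 := sawQ_le_of_four_le ha
  have hsq : Real.sqrt (sawQ a) ≤ (1 / 400) ^ 2 := by
    rw [show ((1 / 400 : ℝ)) ^ 2 = Real.sqrt ((((1 : ℝ) / 400) ^ 2) ^ 2) by rw [Real.sqrt_sq (by norm_num)]]
    exact Real.sqrt_le_sqrt (by nlinarith)
  have hsq0 := Real.sqrt_nonneg (sawQ a)
  have h1q : 0 < 1 - sawQ a := by norm_num at hq; linarith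
  have b : (1 + sawQ a) / (2 * a * (1 - sawQ a)) + Real.sqrt (sawQ a) / (a * (1 - sawQ a)) ≤ 1.00002 / (2 * a) := by
    rw [show (1 + sawQ a) / (2 * a * (1 - sawQ a)) + Real.sqrt (sawQ a) / (a * (1 - sawQ a)) =
        ((1 + sawQ a) + 2 * Real.sqrt (sawQ a)) / (1 - sawQ a) / (2 * a) by field_simp]
    apply div_le_div_of_nonneg_right _ (by positivity)
    rw [div_le_iff₀ h1q]
    norm_num at hq hsq ⊢
    nlinarith
  linarith

/-- **Energy of the created pair from amplitude bounds** (`a ≥ 4`, any `β`): `‖q₀‖, ‖q₁‖ ≤ B/a` ⇒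
`Σ_n |q₀e^{−iπ(β+n)/2} + q₁e^{iπ(β+n)/2}|²/(4π²(a²+(β+n)²)) ≤ 1.00002·B²/(2πa³)`. [cite: Drazin2002, §8.3 (8.36)–(8.38)] -/
theorem comb_pair_energy_le {a : ℝ} (ha : 4 ≤ a) (β : ℝ) {q₀ q₁ : ℂ} {B : ℝ} (h₀ : ‖q₀‖ ≤ B / a) (h₁ : ‖q₁‖ ≤ B / a) :
    ∑' n : ℤ, ‖q₀ * Complex.exp (-(2 * Real.pi * (β + n) * (1 / 4 : ℝ) : ℝ) * Complex.I) +
          q₁ * Complex.exp (-(2 * Real.pi * (β + n) * (-(1 / 4 : ℝ)) : ℝ) * Complex.I)‖ ^ 2 / (4 * Real.pi ^ 2 * (a ^ 2 + (β + n) ^ 2)) ≤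
      1.00002 * B ^ 2 / (2 * Real.pi * a ^ 3) := by
  have ha0 : 0 < a := by linarith
  have hE := sheetPair_energy_le ha0 β q₀ q₁
  have hG := gram_upper_le_of_four_le ha (-β)
  have hB : 0 ≤ B / a := (norm_nonneg _).trans h₀
  have hn0 : Complex.normSq q₀ ≤ (B / a) ^ 2 := by
    rw [Complex.normSq_eq_norm_sq]; exact pow_le_pow_left₀ (norm_nonneg _) h₀ 2
  have hn1 : Complex.normSq q₁ ≤ (B / a) ^ 2 := by
    rw [Complex.normSq_eq_norm_sq]; exact pow_le_pow_left₀ (norm_nonneg _) h₁ 2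
  have hns : 0 ≤ Complex.normSq q₀ + Complex.normSq q₁ := add_nonneg (Complex.normSq_nonneg _) (Complex.normSq_nonneg _)
  refine hE.trans ?_
  calc (-sawSigma0 a (-β) + Real.sqrt (Complex.normSq (sawS a (-β)))) * (Complex.normSq q₀ + Complex.normSq q₁) / (2 * Real.pi)
      ≤ (1.00002 / (2 * a)) * (2 * (B / a) ^ 2) / (2 * Real.pi) := by
        apply div_le_div_of_nonneg_right _ (by positivity)
        exact mul_le_mul hG (by linarith) hns (by positivity)
    _ = 1.00002 * B ^ 2 / (2 * Real.pi * a ^ 3) := by field_simp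

/-- **The number:** with `B = 0.8865` (the comb-column amplitude of `…KHCombAmplitude`), `a ≥ 4`: created pair energy
`≤ 0.1251/a³ ≤ (4.94/a)·(1/(4π²a²))`. [cite: Drazin2002, §8.3 (8.36)–(8.38)] -/
theorem comb_pair_energy_num_le {a : ℝ} (ha : 4 ≤ a) (β : ℝ) {q₀ q₁ : ℂ} (h₀ : ‖q₀‖ ≤ 0.8865 / a) (h₁ : ‖q₁‖ ≤ 0.8865 / a) :
    ∑' n : ℤ, ‖q₀ * Complex.exp (-(2 * Real.pi * (β + n) * (1 / 4 : ℝ) : ℝ) * Complex.I) +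
          q₁ * Complex.exp (-(2 * Real.pi * (β + n) * (-(1 / 4 : ℝ)) : ℝ) * Complex.I)‖ ^ 2 / (4 * Real.pi ^ 2 * (a ^ 2 + (β + n) ^ 2)) ≤
      4.94 / a * (1 / (4 * Real.pi ^ 2 * a ^ 2)) := by
  have ha0 : 0 < a := by linarith
  have h := comb_pair_energy_le ha β h₀ h₁
  refine h.trans ?_
  have hπ : (3.1415 : ℝ) < Real.pi := Real.pi_gt_d4
  have hπ' : Real.pi < 3.1416 := Real.pi_lt_d4
  rw [show 4.94 / a * (1 / (4 * Real.pi ^ 2 * a ^ 2)) = 4.94 / (4 * Real.pi ^ 2 * a ^ 3) by field_simp,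
    div_le_div_iff₀ (by positivity) (by positivity)]
  have ha3 : 0 < a ^ 3 := by positivity
  nlinarith [mul_pos ha3 Real.pi_pos]

end Summit.AnomalousDissipation.AnomalousDissipation.Theorems.SawtoothPulseCascade.K2PhaseBudget

end
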